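import Summits.QuantumFields.BalabanUV.Beta.ChartConjugationReflection

/-!
# `BalabanUV.Beta.ChartConjugationEnd` — the cell's `hR` END re-stated over the CONJUGATED SOCKETS (Sr-conj)/(Wr-conj), in commutator
# form and in an2's transpose letters (β sub-cell, row BETA-an5, gen 18; file 4 of 4 of the chart-conjugation leaf; item (iv) of
# X-an2-40 §5 / β-lead RULING (R33-A-2′); socket shape CONSENTED by an2-g11, journal 2026-08-19T21:00:40Z)

HONEST FRAMING (cell contract, verbatim): «discharging `BetaPertH` makes Bałaban's UV stability UNCONDITIONAL — a real
constructive-QFT result; it is NOT the continuum limit and NOT the Clay problem.»  THIS MODULE mints no `Prop` fact and no `def`, cites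
nothing as a hypothesis, instantiates NO binder of the wall and DISCHARGES NOTHING of it: it re-states the `hR` END of
`ResolventReflection` (`axisReflectionCovariant_flipK_hessKer` / `_TstepOf` / `_TbalOf`) over WEAKER jet-covariance sockets, which remain
BINDERS; `hR_of_cov_conj := this ∘ an2's instantiation (ii)` (RULING (R33-A-2′)).  NOT summit progress.

ABSOLUTE RULE (cell, verbatim): «No internally-minted statement may enter as a cited fact. Every hypothesis is either
kernel-proved in this package or a verbatim quotation of a PUBLISHED theorem with page reference. The manuscript(s) under
audit are NOT citable for their own disputed steps — they are the thing under adjudication; programme-internal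
(2001/route/tribunal) claims are never citable.»  Every theorem below is kernel-proved from explicit, abstract hypotheses.

PLACEMENT.  Cell topic `Summits/QuantumFields/BalabanUV/Beta/` (RULINGS (R34-A), (R33-A-2′)); imports the sibling
`ChartConjugationReflection`; imported by nothing under `Literature/`.

THE SOCKETS (per reflected axis `α`; `K` any packed kernel with a spread two-sided inverse `𝕄` — `comp K 𝕄 = idK`, `comp 𝕄 K = idK`
BINDERS; `C α` a `LocStencil` CONTACT-GENERATOR family on the fine bonds; `X₂ α μ y ν y′` a localised second-order coarse contact):
* (Sr-conj), FINE, commutator form: `J.S κ′ (bref α κ′ u) = ε_κ′ • refK (Φ N α) (J.S κ′ u + conjV 𝕄 (C α κ′ u))`, `conjV 𝕄 X = 𝕄∘X − X∘𝕄`;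
* (Wr-conj), COARSE (the table `J.W` is coarse-indexed): `J.W μ (bref α μ y) ν (bref α ν y′) = (ε_μ ε_ν) • refK (Φ N α) (J.W μ y ν y′ +
  conjW 𝕄 V_{μy} V_{νy′} X_{μy} X_{νy′} (X₂ α μ y ν y′))` with the DERIVED coarse letters `V_{μy} := vertexOfK K N J.S μ y`,
  `X_{μy} := vertexOfK K N (C α) μ y` (`ChartConjugationReflection.vertexOfK_conjV`: the chain rule transports `conjV 𝕄 ∘ C α` to `conjV 𝕄 X`);
* an2's TRANSPOSE LETTERS (`…_conjT`): the same with `comp (trK (C α κ′ u)) 𝕄 + comp 𝕄 (C α κ′ u)` and the nine-term table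
  `XᵀV′ + V′X + X′ᵀV + VX′ + Xᵀ𝕄X′ + X′ᵀ𝕄X + X₂ᵀ𝕄 + 𝕄X₂`, PLUS the binders skewness `trK (C α κ′ u) = −C α κ′ u` and the orthogonality jet
  relation `X₂ᵀ + X₂ + XᵀX′ + X′ᵀX = 0` at the coarse letters (discharged by an2 in (ii), CONSENT (a)); bridge = `conjV_eq_transpose` /
  `conjW_eq_transpose` + `trK_vertexOfK` / `vertexOfK_neg`.
CONTENT.  §1 **`axisReflectionCovariant_flipK_hessKer_conj`** (any packed `K`), **`…_TstepOf_conj`**, **`…_TbalOf_conj`** (dimension four, the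
one-step family `TbalOf Lc Js`; kernel-side inputs `decays_/shiftK_/refK_KInvStep` are theorems; `𝕄 j`, the two inverse identities, `C j`,
`X₂ j` and the jet laws (St), (Wt), (Sr-conj), (Wr-conj) are BINDERS); §2 the same three in transpose letters (`…_conjT`).
NOT continuum, NOT Clay.
-/

open Finset
open scoped BigOperators
open Literature.MathematicalPhysics.QuantumFieldTheory.Balaban1983to89
open Literature.MathematicalPhysics.QuantumFieldTheory.Balaban1983to89.Beta
open B12Sec2to5 (l1 l1_nonneg)
open ExpKernelCalculus (MKer Decays BiLoc comp tr bubble tadpole hess hessKer hess_eq_hessKer BlockCovariant VertexFamily VertexFamily₂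
  summable_exp_shift summable_exp_shift' biLoc_comp_decays)
open PolarizationSign (axisReflect axisReflect_apply reflSign AxisReflectionCovariant)
open KernelReflection (LegMap refK refK_apply bondRefl bondRefl_sub comp_refK tr_refK summable_trSlice tadpole_smul bubble_smul_left
  bubble_smul_right)
open KernelWard (bdd_of_biLoc bdd_of_decays tsum_comm_of_prodBound comp_finset_sum_right comp_finset_sum_left)
open HessKerSchurResolvent (idK)
open OneStepResolventKernel (Fib wsum biLoc_wsum LocStencil JetData)
open OneStepKernelFamily (KInvStep decays_KInvStep shiftK_KInvStep colH abs_colH_le vertexOfK vertexFamily_vertexOfK' TstepOf TbalOf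
  flipK)
open ResolventReflection (bref bref_bref bref_eq_bondRefl Φ Φ_s_inl Φ_s_inr Φ_r_inl Φ_r_inr colH_reflect reflSign_mul_self refK_KInvStep
  vertexOfK_translate_block)
open Summit.QuantumFields.BalabanUV.Beta.TameKernelCalculus
open Summit.QuantumFields.BalabanUV.Beta.ChartConjugation
open Summit.QuantumFields.BalabanUV.Beta.ChartConjugationReflection

namespace Summit.QuantumFields.BalabanUV.Beta.ChartConjugationEnd

noncomputable section

/-! ## §1 The `hR` ENDs over the conjugated sockets (commutator form) -/

section End

variable {d N : ℕ}

/-- **THE TYPED REFLECTION LAW OF A RESOLVENT HESSIAN KERNEL FROM CONJUGATED JET COVARIANCE.**  For ANY packed kernel `K` that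
decays, is block-translation covariant and reflection-invariant for every axis and has a spread two-sided inverse `𝕄` (BINDERS
`comp K 𝕄 = idK`, `comp 𝕄 K = idK`), and any jet datum `J` whose stencil family obeys (St) and the CONJUGATED law (Sr-conj) with local
contact-generator families `C α`, and whose second-order family obeys (Wt) and (Wr-conj) with localised second-order contacts `X₂ α`:
`AxisReflectionCovariant (flipK (hessKer K (vertexOfK K N J.S) J.W))` — the conclusion of
`ResolventReflection.axisReflectionCovariant_flipK_hessKer`, verbatim.  All covariances are HYPOTHESES (binders), never facts. -/
theorem axisReflectionCovariant_flipK_hessKer_conj {K M : MKer (d + 1) (Fib d)}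
    (hKd : ∃ δ C : ℝ, 0 < δ ∧ 0 ≤ C ∧ Decays K C δ) (hKs : ∀ t : Fin (d + 1) → ℤ, ExpKernelCalculus.shiftK (-((N : ℤ) • t)) K = K)
    (hKr : ∀ α : Fin (d + 1), refK (Φ N α) K = K) (hM : Spr M) (hKM : comp K M = idK) (hMK : comp M K = idK) (J : JetData d N)
    (hSt : ∀ (κ' : Fin (d + 1)) (u t : Fin (d + 1) → ℤ), J.S κ' (u + (N : ℤ) • t) = ExpKernelCalculus.shiftK (-((N : ℤ) • t)) (J.S κ' u))
    (hWt : ∀ (μ : Fin (d + 1)) (y : Fin (d + 1) → ℤ) (ν : Fin (d + 1)) (y' t : Fin (d + 1) → ℤ),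
      J.W μ (y + t) ν (y' + t) = ExpKernelCalculus.shiftK (-((N : ℤ) • t)) (J.W μ y ν y'))
    (C : Fin (d + 1) → Fin (d + 1) → (Fin (d + 1) → ℤ) → MKer (d + 1) (Fib d)) {Cc δc : ℝ} (hC : ∀ α, LocStencil (C α) Cc δc)
    (hδc : 0 < δc) (X₂ : Fin (d + 1) → Fin (d + 1) → (Fin (d + 1) → ℤ) → Fin (d + 1) → (Fin (d + 1) → ℤ) → MKer (d + 1) (Fib d))
    (hX₂ : ∀ α μ y ν y', Loc (X₂ α μ y ν y'))
    (hSrC : ∀ (α κ' : Fin (d + 1)) (u : Fin (d + 1) → ℤ),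
      J.S κ' (bref α κ' u) = reflSign α κ' • refK (Φ N α) (J.S κ' u + conjV M (C α κ' u)))
    (hWrC : ∀ (α μ : Fin (d + 1)) (y : Fin (d + 1) → ℤ) (ν : Fin (d + 1)) (y' : Fin (d + 1) → ℤ),
      J.W μ (bref α μ y) ν (bref α ν y') = (reflSign α μ * reflSign α ν) • refK (Φ N α) (J.W μ y ν y' +
        conjW M (vertexOfK K N J.S μ y) (vertexOfK K N J.S ν y') (vertexOfK K N (C α) μ y) (vertexOfK K N (C α) ν y')
          (X₂ α μ y ν y'))) :
    AxisReflectionCovariant (flipK (hessKer K (vertexOfK K N J.S) J.W)) := by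
  obtain ⟨Cv, δv, hδv, hV⟩ := vertexFamily_vertexOfK' (N := N) hKd J.loc J.δ_pos
  have hKspr : Spr K := by obtain ⟨δK, CK, hδK, _, hK⟩ := hKd; exact ⟨CK, δK, hδK, hK⟩
  have hVl : ∀ μ y, Loc (vertexOfK K N J.S μ y) := fun μ y => ⟨_, _, Cv, δv, hδv, hV μ y⟩
  have hWl : ∀ μ y ν y', Loc (J.W μ y ν y') := fun μ y ν y' => ⟨_, _, J.Cw, J.δ, J.δ_pos, J.loc₂ μ y ν y'⟩
  have hcov : BlockCovariant K (vertexOfK K N J.S) J.W N := ⟨hKs, vertexOfK_translate_block hKs hSt, hWt⟩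
  refine axisReflectionCovariant_flip_hessKer_conj hKspr hM hKM hMK hcov hVl hWl fun α => ⟨Φ N α, hKr α, 1, vertexOfK K N (C α),
    X₂ α, fun μ y => ?_, hX₂ α, fun μ y => ?_, fun μ y ν y' => ?_⟩
  · obtain ⟨Cx, δx, hδx, hXv⟩ := vertexFamily_vertexOfK' (N := N) hKd (hC α) hδc
    exact ⟨_, _, Cx, δx, hδx, hXv μ y⟩
  · rw [← bref_eq_bondRefl]
    exact vertexOfK_reflect_conj (hKr α) hKd hM J.loc J.δ_pos (hC α) hδc (hSrC α) μ y
  · rw [← bref_eq_bondRefl, ← bref_eq_bondRefl]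
    exact hWrC α μ y ν y'

/-- **THE GENUINE STEP-`j` KERNEL** `TstepOf Lc j J = hessKer (KInvStep Lc j) (vertexOfK …) J.W`: the typed reflection law from CONJUGATED
jet covariance (kernel-side inputs `decays_/shiftK_/refK_KInvStep` are theorems; `𝕄`, the two inverse identities, `C`, `X₂` are binders). -/
theorem axisReflectionCovariant_flipK_TstepOf_conj {Lc : ℕ} [NeZero Lc] (j : ℕ) (J : JetData d Lc) {M : MKer (d + 1) (Fib d)}
    (hM : Spr M) (hKM : comp (KInvStep (d := d) Lc j) M = idK) (hMK : comp M (KInvStep (d := d) Lc j) = idK)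
    (hSt : ∀ (κ' : Fin (d + 1)) (u t : Fin (d + 1) → ℤ), J.S κ' (u + (Lc : ℤ) • t) = ExpKernelCalculus.shiftK (-((Lc : ℤ) • t)) (J.S κ' u))
    (hWt : ∀ (μ : Fin (d + 1)) (y : Fin (d + 1) → ℤ) (ν : Fin (d + 1)) (y' t : Fin (d + 1) → ℤ),
      J.W μ (y + t) ν (y' + t) = ExpKernelCalculus.shiftK (-((Lc : ℤ) • t)) (J.W μ y ν y'))
    (C : Fin (d + 1) → Fin (d + 1) → (Fin (d + 1) → ℤ) → MKer (d + 1) (Fib d)) {Cc δc : ℝ} (hC : ∀ α, LocStencil (C α) Cc δc)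
    (hδc : 0 < δc) (X₂ : Fin (d + 1) → Fin (d + 1) → (Fin (d + 1) → ℤ) → Fin (d + 1) → (Fin (d + 1) → ℤ) → MKer (d + 1) (Fib d))
    (hX₂ : ∀ α μ y ν y', Loc (X₂ α μ y ν y'))
    (hSrC : ∀ (α κ' : Fin (d + 1)) (u : Fin (d + 1) → ℤ),
      J.S κ' (bref α κ' u) = reflSign α κ' • refK (Φ Lc α) (J.S κ' u + conjV M (C α κ' u)))
    (hWrC : ∀ (α μ : Fin (d + 1)) (y : Fin (d + 1) → ℤ) (ν : Fin (d + 1)) (y' : Fin (d + 1) → ℤ),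
      J.W μ (bref α μ y) ν (bref α ν y') = (reflSign α μ * reflSign α ν) • refK (Φ Lc α) (J.W μ y ν y' +
        conjW M (vertexOfK (KInvStep Lc j) Lc J.S μ y) (vertexOfK (KInvStep Lc j) Lc J.S ν y')
          (vertexOfK (KInvStep Lc j) Lc (C α) μ y) (vertexOfK (KInvStep Lc j) Lc (C α) ν y') (X₂ α μ y ν y'))) :
    AxisReflectionCovariant (flipK (TstepOf Lc j J)) := by
  unfold TstepOf
  exact axisReflectionCovariant_flipK_hessKer_conj (decays_KInvStep j) (shiftK_KInvStep j) (fun α => refK_KInvStep j α) hM hKM hMK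
    J hSt hWt C hC hδc X₂ hX₂ hSrC hWrC

/-- **THE `hR` BINDER OF `OneStepKernelFamily.d1Drift_of_D1Tel_D1Rep` FROM CONJUGATED JET COVARIANCE** (dimension four, the one-step family
`TbalOf Lc Js`): per step `j` a spread two-sided inverse `𝕄 j` of `KInvStep Lc j`, contact-generator families `C j α`, second-order
contacts `X₂ j α`, and the six jet laws (St), (Wt), (Sr-conj), (Wr-conj) — all BINDERS — give `∀ j, AxisReflectionCovariant (flipK (TbalOf
Lc Js j))`.  `hR_of_cov_conj := this ∘ an2's instantiation (ii)` (RULING (R33-A-2′)); NOT summit progress. -/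
theorem axisReflectionCovariant_flipK_TbalOf_conj {Lc : ℕ} [NeZero Lc] (Js : ℕ → JetData 3 Lc) (M : ℕ → MKer 4 (Fib 3))
    (hM : ∀ j, Spr (M j)) (hKM : ∀ j, comp (KInvStep (d := 3) Lc j) (M j) = idK) (hMK : ∀ j, comp (M j) (KInvStep (d := 3) Lc j) = idK)
    (hSt : ∀ (j : ℕ) (κ' : Fin 4) (u t : Fin 4 → ℤ), (Js j).S κ' (u + (Lc : ℤ) • t) = ExpKernelCalculus.shiftK (-((Lc : ℤ) • t)) ((Js j).S κ' u))
    (hWt : ∀ (j : ℕ) (μ : Fin 4) (y : Fin 4 → ℤ) (ν : Fin 4) (y' t : Fin 4 → ℤ),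
      (Js j).W μ (y + t) ν (y' + t) = ExpKernelCalculus.shiftK (-((Lc : ℤ) • t)) ((Js j).W μ y ν y'))
    (C : ℕ → Fin 4 → Fin 4 → (Fin 4 → ℤ) → MKer 4 (Fib 3)) (Cc δc : ℕ → ℝ) (hC : ∀ j α, LocStencil (C j α) (Cc j) (δc j))
    (hδc : ∀ j, 0 < δc j) (X₂ : ℕ → Fin 4 → Fin 4 → (Fin 4 → ℤ) → Fin 4 → (Fin 4 → ℤ) → MKer 4 (Fib 3))
    (hX₂ : ∀ j α μ y ν y', Loc (X₂ j α μ y ν y'))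
    (hSrC : ∀ (j : ℕ) (α κ' : Fin 4) (u : Fin 4 → ℤ),
      (Js j).S κ' (bref α κ' u) = reflSign α κ' • refK (Φ Lc α) ((Js j).S κ' u + conjV (M j) (C j α κ' u)))
    (hWrC : ∀ (j : ℕ) (α μ : Fin 4) (y : Fin 4 → ℤ) (ν : Fin 4) (y' : Fin 4 → ℤ),
      (Js j).W μ (bref α μ y) ν (bref α ν y') = (reflSign α μ * reflSign α ν) • refK (Φ Lc α) ((Js j).W μ y ν y' +
        conjW (M j) (vertexOfK (KInvStep Lc j) Lc (Js j).S μ y) (vertexOfK (KInvStep Lc j) Lc (Js j).S ν y')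
          (vertexOfK (KInvStep Lc j) Lc (C j α) μ y) (vertexOfK (KInvStep Lc j) Lc (C j α) ν y') (X₂ j α μ y ν y'))) :
    ∀ j : ℕ, AxisReflectionCovariant (flipK (TbalOf Lc Js j)) :=
  fun j => axisReflectionCovariant_flipK_TstepOf_conj j (Js j) (hM j) (hKM j) (hMK j) (hSt j) (hWt j) (C j) (hC j) (hδc j) (X₂ j)
    (hX₂ j) (hSrC j) (hWrC j)


/-! ## §2 The same ENDs in an2's transpose letters (skewness and the orthogonality jet relation as binders) -/

/-- Skewness of the fine contact generators gives skewness of the coarse letters `X_{μy} = vertexOfK K N C μ y`. -/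
theorem trK_vertexOfK_of_skew (K : MKer (d + 1) (Fib d)) {C : Fin (d + 1) → (Fin (d + 1) → ℤ) → MKer (d + 1) (Fib d)}
    (hskew : ∀ κ' u, trK (C κ' u) = -C κ' u) (μ : Fin (d + 1)) (y : Fin (d + 1) → ℤ) :
    trK (vertexOfK K N C μ y) = -vertexOfK K N C μ y := by
  rw [trK_vertexOfK, ← vertexOfK_neg]
  congr 1
  funext κ' u
  exact hskew κ' u

/-- **THE TYPED REFLECTION LAW FROM CONJUGATED JET COVARIANCE, an2's TRANSPOSE LETTERS** (CONSENT 2026-08-19T21:00:40Z (a)/(b): contact on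
the source side inside `refK`, written `Cᵀ𝕄 + 𝕄C`; skewness and the orthogonality jet relation as separate binders). -/
theorem axisReflectionCovariant_flipK_hessKer_conjT {K M : MKer (d + 1) (Fib d)}
    (hKd : ∃ δ C : ℝ, 0 < δ ∧ 0 ≤ C ∧ Decays K C δ) (hKs : ∀ t : Fin (d + 1) → ℤ, ExpKernelCalculus.shiftK (-((N : ℤ) • t)) K = K)
    (hKr : ∀ α : Fin (d + 1), refK (Φ N α) K = K) (hM : Spr M) (hKM : comp K M = idK) (hMK : comp M K = idK) (J : JetData d N)
    (hSt : ∀ (κ' : Fin (d + 1)) (u t : Fin (d + 1) → ℤ), J.S κ' (u + (N : ℤ) • t) = ExpKernelCalculus.shiftK (-((N : ℤ) • t)) (J.S κ' u))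
    (hWt : ∀ (μ : Fin (d + 1)) (y : Fin (d + 1) → ℤ) (ν : Fin (d + 1)) (y' t : Fin (d + 1) → ℤ),
      J.W μ (y + t) ν (y' + t) = ExpKernelCalculus.shiftK (-((N : ℤ) • t)) (J.W μ y ν y'))
    (C : Fin (d + 1) → Fin (d + 1) → (Fin (d + 1) → ℤ) → MKer (d + 1) (Fib d)) {Cc δc : ℝ} (hC : ∀ α, LocStencil (C α) Cc δc)
    (hδc : 0 < δc) (hCskew : ∀ α κ' u, trK (C α κ' u) = -C α κ' u)
    (X₂ : Fin (d + 1) → Fin (d + 1) → (Fin (d + 1) → ℤ) → Fin (d + 1) → (Fin (d + 1) → ℤ) → MKer (d + 1) (Fib d))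
    (hX₂ : ∀ α μ y ν y', Loc (X₂ α μ y ν y'))
    (horth : ∀ (α μ : Fin (d + 1)) (y : Fin (d + 1) → ℤ) (ν : Fin (d + 1)) (y' : Fin (d + 1) → ℤ),
      trK (X₂ α μ y ν y') + X₂ α μ y ν y' + comp (trK (vertexOfK K N (C α) μ y)) (vertexOfK K N (C α) ν y')
        + comp (trK (vertexOfK K N (C α) ν y')) (vertexOfK K N (C α) μ y) = 0)
    (hSrT : ∀ (α κ' : Fin (d + 1)) (u : Fin (d + 1) → ℤ),
      J.S κ' (bref α κ' u) = reflSign α κ' • refK (Φ N α) (J.S κ' u + (comp (trK (C α κ' u)) M + comp M (C α κ' u))))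
    (hWrT : ∀ (α μ : Fin (d + 1)) (y : Fin (d + 1) → ℤ) (ν : Fin (d + 1)) (y' : Fin (d + 1) → ℤ),
      J.W μ (bref α μ y) ν (bref α ν y') = (reflSign α μ * reflSign α ν) • refK (Φ N α) (J.W μ y ν y' +
        (comp (trK (vertexOfK K N (C α) μ y)) (vertexOfK K N J.S ν y') + comp (vertexOfK K N J.S ν y') (vertexOfK K N (C α) μ y)
          + comp (trK (vertexOfK K N (C α) ν y')) (vertexOfK K N J.S μ y) + comp (vertexOfK K N J.S μ y) (vertexOfK K N (C α) ν y')
          + comp (comp (trK (vertexOfK K N (C α) μ y)) M) (vertexOfK K N (C α) ν y')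
          + comp (comp (trK (vertexOfK K N (C α) ν y')) M) (vertexOfK K N (C α) μ y)
          + comp (trK (X₂ α μ y ν y')) M + comp M (X₂ α μ y ν y')))) :
    AxisReflectionCovariant (flipK (hessKer K (vertexOfK K N J.S) J.W)) := by
  have hXl : ∀ α μ y, Loc (vertexOfK K N (C α) μ y) := fun α μ y => by
    obtain ⟨Cx, δx, hδx, hXv⟩ := vertexFamily_vertexOfK' (N := N) hKd (hC α) hδc
    exact ⟨_, _, Cx, δx, hδx, hXv μ y⟩
  have hXskew : ∀ α μ y, trK (vertexOfK K N (C α) μ y) = -vertexOfK K N (C α) μ y := fun α =>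
    trK_vertexOfK_of_skew K (hCskew α)
  refine axisReflectionCovariant_flipK_hessKer_conj hKd hKs hKr hM hKM hMK J hSt hWt C hC hδc X₂ hX₂ (fun α κ' u => ?_)
    (fun α μ y ν y' => ?_)
  · rw [hSrT, conjV_eq_transpose M (hCskew α κ' u)]
  · rw [hWrT, conjW_eq_transpose hM (hXl α μ y) (hXl α ν y') (hX₂ α μ y ν y') (hXskew α μ y) (hXskew α ν y') (horth α μ y ν y')]

/-- The step-`j` kernel `TstepOf Lc j J`, transpose letters. -/
theorem axisReflectionCovariant_flipK_TstepOf_conjT {Lc : ℕ} [NeZero Lc] (j : ℕ) (J : JetData d Lc) {M : MKer (d + 1) (Fib d)}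
    (hM : Spr M) (hKM : comp (KInvStep (d := d) Lc j) M = idK) (hMK : comp M (KInvStep (d := d) Lc j) = idK)
    (hSt : ∀ (κ' : Fin (d + 1)) (u t : Fin (d + 1) → ℤ), J.S κ' (u + (Lc : ℤ) • t) = ExpKernelCalculus.shiftK (-((Lc : ℤ) • t)) (J.S κ' u))
    (hWt : ∀ (μ : Fin (d + 1)) (y : Fin (d + 1) → ℤ) (ν : Fin (d + 1)) (y' t : Fin (d + 1) → ℤ),
      J.W μ (y + t) ν (y' + t) = ExpKernelCalculus.shiftK (-((Lc : ℤ) • t)) (J.W μ y ν y'))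
    (C : Fin (d + 1) → Fin (d + 1) → (Fin (d + 1) → ℤ) → MKer (d + 1) (Fib d)) {Cc δc : ℝ} (hC : ∀ α, LocStencil (C α) Cc δc)
    (hδc : 0 < δc) (hCskew : ∀ α κ' u, trK (C α κ' u) = -C α κ' u)
    (X₂ : Fin (d + 1) → Fin (d + 1) → (Fin (d + 1) → ℤ) → Fin (d + 1) → (Fin (d + 1) → ℤ) → MKer (d + 1) (Fib d))
    (hX₂ : ∀ α μ y ν y', Loc (X₂ α μ y ν y'))
    (horth : ∀ (α μ : Fin (d + 1)) (y : Fin (d + 1) → ℤ) (ν : Fin (d + 1)) (y' : Fin (d + 1) → ℤ),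
      trK (X₂ α μ y ν y') + X₂ α μ y ν y'
        + comp (trK (vertexOfK (KInvStep Lc j) Lc (C α) μ y)) (vertexOfK (KInvStep Lc j) Lc (C α) ν y')
        + comp (trK (vertexOfK (KInvStep Lc j) Lc (C α) ν y')) (vertexOfK (KInvStep Lc j) Lc (C α) μ y) = 0)
    (hSrT : ∀ (α κ' : Fin (d + 1)) (u : Fin (d + 1) → ℤ),
      J.S κ' (bref α κ' u) = reflSign α κ' • refK (Φ Lc α) (J.S κ' u + (comp (trK (C α κ' u)) M + comp M (C α κ' u))))
    (hWrT : ∀ (α μ : Fin (d + 1)) (y : Fin (d + 1) → ℤ) (ν : Fin (d + 1)) (y' : Fin (d + 1) → ℤ),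
      J.W μ (bref α μ y) ν (bref α ν y') = (reflSign α μ * reflSign α ν) • refK (Φ Lc α) (J.W μ y ν y' +
        (comp (trK (vertexOfK (KInvStep Lc j) Lc (C α) μ y)) (vertexOfK (KInvStep Lc j) Lc J.S ν y')
          + comp (vertexOfK (KInvStep Lc j) Lc J.S ν y') (vertexOfK (KInvStep Lc j) Lc (C α) μ y)
          + comp (trK (vertexOfK (KInvStep Lc j) Lc (C α) ν y')) (vertexOfK (KInvStep Lc j) Lc J.S μ y)
          + comp (vertexOfK (KInvStep Lc j) Lc J.S μ y) (vertexOfK (KInvStep Lc j) Lc (C α) ν y')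
          + comp (comp (trK (vertexOfK (KInvStep Lc j) Lc (C α) μ y)) M) (vertexOfK (KInvStep Lc j) Lc (C α) ν y')
          + comp (comp (trK (vertexOfK (KInvStep Lc j) Lc (C α) ν y')) M) (vertexOfK (KInvStep Lc j) Lc (C α) μ y)
          + comp (trK (X₂ α μ y ν y')) M + comp M (X₂ α μ y ν y')))) :
    AxisReflectionCovariant (flipK (TstepOf Lc j J)) := by
  unfold TstepOf
  exact axisReflectionCovariant_flipK_hessKer_conjT (decays_KInvStep j) (shiftK_KInvStep j) (fun α => refK_KInvStep j α) hM hKM hMK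
    J hSt hWt C hC hδc hCskew X₂ hX₂ horth hSrT hWrT

/-- **THE `hR` BINDER FROM CONJUGATED JET COVARIANCE, an2's TRANSPOSE LETTERS** (dimension four, the one-step family `TbalOf Lc Js`). -/
theorem axisReflectionCovariant_flipK_TbalOf_conjT {Lc : ℕ} [NeZero Lc] (Js : ℕ → JetData 3 Lc) (M : ℕ → MKer 4 (Fib 3))
    (hM : ∀ j, Spr (M j)) (hKM : ∀ j, comp (KInvStep (d := 3) Lc j) (M j) = idK) (hMK : ∀ j, comp (M j) (KInvStep (d := 3) Lc j) = idK)
    (hSt : ∀ (j : ℕ) (κ' : Fin 4) (u t : Fin 4 → ℤ), (Js j).S κ' (u + (Lc : ℤ) • t) = ExpKernelCalculus.shiftK (-((Lc : ℤ) • t)) ((Js j).S κ' u))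
    (hWt : ∀ (j : ℕ) (μ : Fin 4) (y : Fin 4 → ℤ) (ν : Fin 4) (y' t : Fin 4 → ℤ),
      (Js j).W μ (y + t) ν (y' + t) = ExpKernelCalculus.shiftK (-((Lc : ℤ) • t)) ((Js j).W μ y ν y'))
    (C : ℕ → Fin 4 → Fin 4 → (Fin 4 → ℤ) → MKer 4 (Fib 3)) (Cc δc : ℕ → ℝ) (hC : ∀ j α, LocStencil (C j α) (Cc j) (δc j))
    (hδc : ∀ j, 0 < δc j) (hCskew : ∀ j α κ' u, trK (C j α κ' u) = -C j α κ' u)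
    (X₂ : ℕ → Fin 4 → Fin 4 → (Fin 4 → ℤ) → Fin 4 → (Fin 4 → ℤ) → MKer 4 (Fib 3)) (hX₂ : ∀ j α μ y ν y', Loc (X₂ j α μ y ν y'))
    (horth : ∀ (j : ℕ) (α μ : Fin 4) (y : Fin 4 → ℤ) (ν : Fin 4) (y' : Fin 4 → ℤ),
      trK (X₂ j α μ y ν y') + X₂ j α μ y ν y'
        + comp (trK (vertexOfK (KInvStep Lc j) Lc (C j α) μ y)) (vertexOfK (KInvStep Lc j) Lc (C j α) ν y')
        + comp (trK (vertexOfK (KInvStep Lc j) Lc (C j α) ν y')) (vertexOfK (KInvStep Lc j) Lc (C j α) μ y) = 0)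
    (hSrT : ∀ (j : ℕ) (α κ' : Fin 4) (u : Fin 4 → ℤ),
      (Js j).S κ' (bref α κ' u) = reflSign α κ' • refK (Φ Lc α) ((Js j).S κ' u + (comp (trK (C j α κ' u)) (M j) + comp (M j) (C j α κ' u))))
    (hWrT : ∀ (j : ℕ) (α μ : Fin 4) (y : Fin 4 → ℤ) (ν : Fin 4) (y' : Fin 4 → ℤ),
      (Js j).W μ (bref α μ y) ν (bref α ν y') = (reflSign α μ * reflSign α ν) • refK (Φ Lc α) ((Js j).W μ y ν y' +
        (comp (trK (vertexOfK (KInvStep Lc j) Lc (C j α) μ y)) (vertexOfK (KInvStep Lc j) Lc (Js j).S ν y')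
          + comp (vertexOfK (KInvStep Lc j) Lc (Js j).S ν y') (vertexOfK (KInvStep Lc j) Lc (C j α) μ y)
          + comp (trK (vertexOfK (KInvStep Lc j) Lc (C j α) ν y')) (vertexOfK (KInvStep Lc j) Lc (Js j).S μ y)
          + comp (vertexOfK (KInvStep Lc j) Lc (Js j).S μ y) (vertexOfK (KInvStep Lc j) Lc (C j α) ν y')
          + comp (comp (trK (vertexOfK (KInvStep Lc j) Lc (C j α) μ y)) (M j)) (vertexOfK (KInvStep Lc j) Lc (C j α) ν y')
          + comp (comp (trK (vertexOfK (KInvStep Lc j) Lc (C j α) ν y')) (M j)) (vertexOfK (KInvStep Lc j) Lc (C j α) μ y)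
          + comp (trK (X₂ j α μ y ν y')) (M j) + comp (M j) (X₂ j α μ y ν y')))) :
    ∀ j : ℕ, AxisReflectionCovariant (flipK (TbalOf Lc Js j)) :=
  fun j => axisReflectionCovariant_flipK_TstepOf_conjT j (Js j) (hM j) (hKM j) (hMK j) (hSt j) (hWt j) (C j) (hC j) (hδc j) (hCskew j)
    (X₂ j) (hX₂ j) (horth j) (hSrT j) (hWrT j)

end End

end

end Summit.QuantumFields.BalabanUV.Beta.ChartConjugationEnd
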